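import Summits.NavierStokesRegularity.NavierStokesRegularity.Theorems.PeepholeVorticityDoorDefs
import Literature.Analysis.FluidPDE.NSLocalAnalyticityRadius

/-!
# ScalingDefectPeepholeDoorDefs — door S30 «ScalingDefectPeepholeDoor», VORTICITY-DEFECT form: texts + kernel-checked compositions
# (= nsreg-p1 g24 `r28/Sketch30v2.lean` 325dd7ac74e245e5 VERBATIM, ROUND-28 v2 texts of record 6cf1a9889313ec10, refuter1 K-74 PASS 8/8;
# plate P0 landed by ns-s29-p2 g2 per DIRECTOR-NS #165 (1); every open statement is a `def … : Prop`, no proof placeholders)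

v2 supersedes the v1 texts `DefectTubeBound` (K1) and `DefectPeepholeToCore`, which are REFUTABLE AS TYPED in the
integral-pressure class by irrotational «parasite» solutions (Serrin potential flows `u = a(t)∇φ`, `p = −a′φ − ½a²|∇φ|²`
with a spike of `a′` at the observation time; ROUND-28 v2 §(10)).  Two changes, nothing else:

(α) CLASS := Pineau–Vicol's own class of Theorem 1.9 — local Type I (1.15) AND the POINTWISE annular pressure bound (1.16)
    `|p(t,x)| ≤ C_p` on `{1/2 < |x| < 3/4} × [−1,0)` — verbatim the hypothesis block of the tree's
    `Literature.Analysis.FluidPDE.pineauVicol2026_oneSlice_regularity` (quantifier shape `∀ C_u … ∃ ε … ∀ C_p ∃ s₀`).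
(β) DATUM := the VORTICITY-defect, the curl of Pineau–Vicol's (1.17) field: for a classical solution
    `curl((−t)∂ₜu − ½u − ½(x·∇)u) = (−t)∂ₜω − ω − ½(x·∇)ω = (−t)(Δω − (u·∇)ω + (ω·∇)u) − ω − ½(x·∇)ω`, i.e.
    `∂ₛΩ` for `Ω(y,s) = (−t)ω(√(−t)y, t)`; it is typed SPATIALLY (slice-intrinsic: no time derivative, no pressure,
    gauge-invariant), as the scale-free operator `vortexDefect ν` applied to the window field
    `physWindowField T x₀ u t = √(T−t)·u(t, x₀ + √(T−t)·)` of S23–S29.  Irrotational parasites have datum `≡ 0`.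

THE DOOR (door frame of S23–S29, class-uniform ONE-TIME form, EFFECTIVE in shape): local Type I(`M`) at `(x₀,T)` and, at ONE
class-late time `t̄`, `‖∂ₛΩ‖ ≤ ε(ν, M, y₀, r)` on ONE ball peephole `B_r(y₀)` of the similarity window (physically
`B(x₀ + √(T−t̄)y₀, √(T−t̄)r)`) ⇒ `(x₀,T)` is regular.  «A Type-I singularity cannot look, through any keyhole at any single
late instant, like a slice of a self-similar VORTICITY profile.»  Exact self-similarity has datum `0`; S29's datum
`(T−t̄)|ω|` is `O(1)` there — the two doors see independent data.

CHAIN (all in the PV frame `ν = 1`, apex `(0,0)`, region `[−1,0) × B₁`):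
  K1ω `VortexDefectTubeBound` + K2 `TubePropagation` ⟹ `VortexDefectPeepholeToCore` (PROVED here)
  ⟹ with LEG Cω `QuietVortexCoreRigidity` (one-slice rigidity: core `∂ₛΩ`-small ⇒ L²-small core vorticity; compactness +
     Poincaré lemma + tree `tsai_selfsimilar_holds`) and the core-vorticity criterion `RegularOfQuietCoreVorticity` (the body of
     the tree's `pineauVicol2026_oneSlice_regularity_of_core'` / S29 `pvPeepholeRegularityInt_of_peepholeToCore` after their
     hB-slot) ⟹ `PVVortexDefectPeepholeRegularity` (PROVED here) ⟹ frame stub ⟹ `TargetVortexDefectPeephole`.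
no proof placeholders; open statements are `def … : Prop`.
-/

noncomputable section

set_option linter.dupNamespace false

namespace Summit.NavierStokesRegularity.NavierStokesRegularity.Theorems.ScalingDefectPeepholeDoor

open MeasureTheory Set Function Filter Topology TopologicalSpace Metric
open scoped RealInnerProductSpace NNReal ENNReal Topology Laplacian
open Literature.Analysis Literature.Analysis.FluidPDE
open Literature.Analysis.FunctionSpaces.EuclideanSpace (complexify norm_complexify)
open Summit.NavierStokesRegularity.NavierStokesRegularity.Theorems.StableStrataDoorDefs (physWindowField)

/-! ## §0 The observable: the scale-free self-similar residual and its curl, the vorticity defect -/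

/-- **self-similar residual** at viscosity `ν` of a window field `F` (similarity variables `y`):
`N_ν F = ν ΔF − (F·∇)F − ½F − ½(y·∇)F`.  For `F = physWindowField T x₀ u t = √(T−t)·u(t, x₀ + √(T−t)·)` and `(u,p)` a
classical solution, `N_ν F = ∂ₛU + ∇P` with `U, P` the similarity profiles about `(x₀,T)` (`P = (T−t)p`): Pineau–Vicol's
(1.17) field `√(T−t)((T−t)∂ₜu − ½u − ½((x−x₀)·∇)u)` is `N_ν F − ∇P` — pressure-DEPENDENT (the v1 datum). -/
def ssResidual (ν : ℝ) (F : EuclideanSpace ℝ (Fin 3) → EuclideanSpace ℝ (Fin 3)) (y : EuclideanSpace ℝ (Fin 3)) :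
    EuclideanSpace ℝ (Fin 3) :=
  ν • (Δ F) y - fderiv ℝ F y (F y) - (1 / 2 : ℝ) • F y - (1 / 2 : ℝ) • fderiv ℝ F y y

/-- **vorticity defect** `𝔇_ν F := curl (N_ν F)` — for a classical solution `= curl ∂ₛU = ∂ₛΩ = (T−t)·[(T−t)∂ₜω − ω −
½((x−x₀)·∇)ω]` (`Ω = curl_y U = (T−t)ω`), i.e. for `div F = 0` the expanded form
`ν Δ(curl F) − (F·∇)curl F + (curl F·∇)F − curl F − ½(y·∇)curl F`: the infinitesimal deviation of the VORTICITY from backward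
self-similarity about `(x₀,T)`.  Pressure-free, gauge-free, purely spatial in the slice `u(t,·)`; `≡ 0` on irrotational
(potential-flow) slices and on exactly self-similar ones. -/
def vortexDefect (ν : ℝ) (F : EuclideanSpace ℝ (Fin 3) → EuclideanSpace ℝ (Fin 3)) (y : EuclideanSpace ℝ (Fin 3)) :
    EuclideanSpace ℝ (Fin 3) :=
  curl (ssResidual ν F) y

/-! ## §1 The door texts (physical frame of S23–S29; class-uniform one-time form, shape of `TargetPeepholeVorticityAt`) -/

/-- **door S30 (v2) at `(ν, M, y₀, r)`:** some `ε > 0` such that for every class `(T, ρ, E₀)` there is ONE lateness threshold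
`t⋆ < T` serving every classical Leray–Hopf solution with life span `T`, initial kinetic energy `≤ E₀` and local Type I(`M`)
on `Q_ρ(x₀,T)`: vorticity-defect `≤ ε` on the similarity peephole `B_r(y₀)` at ONE time `t̄ ∈ (t⋆, T)` excludes the
singularity at `(x₀, T)`. -/
def TargetVortexDefectPeepholeAt (ν M : ℝ) (y₀ : EuclideanSpace ℝ (Fin 3)) (r : ℝ) : Prop :=
  ∃ ε : ℝ, 0 < ε ∧ ∀ (T ρ E₀ : ℝ), 0 < T → 0 < ρ → ∃ tstar : ℝ, tstar < T ∧
    ∀ (u : ℝ → EuclideanSpace ℝ (Fin 3) → EuclideanSpace ℝ (Fin 3)) (p : ℝ → EuclideanSpace ℝ (Fin 3) → ℝ),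
    IsClassicalNSSolutionOn (Set.Ico 0 T) ν 0 u p → IsLerayHopfOn T ν 0 (u 0) u → HasRapidSpatialDecay (u 0) →
    VectorCalculus.kineticEnergy (u 0) ≤ E₀ →
    ∀ (x₀ : EuclideanSpace ℝ (Fin 3)),
    (∀ t ∈ Set.Ico 0 T, T - ρ ^ 2 < t → ∀ x ∈ Metric.ball x₀ ρ, ‖u t x‖ * (‖x - x₀‖ + Real.sqrt (ν * (T - t))) ≤ M) →
    ∀ tb ∈ Set.Ioo tstar T,
      (∀ y ∈ Metric.ball y₀ r, ‖vortexDefect ν (physWindowField T x₀ u tb) y‖ ≤ ε) → IsBackwardBoundedAt u T x₀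

/-- **door S30 (v2):** every viscosity, every Type-I constant, every ball peephole. -/
def TargetVortexDefectPeephole : Prop :=
  ∀ (ν : ℝ), 0 < ν → ∀ (M : ℝ) (y₀ : EuclideanSpace ℝ (Fin 3)) (r : ℝ), 0 < r → TargetVortexDefectPeepholeAt ν M y₀ r

/-! ## §2 The Pineau–Vicol-frame texts (`ν = 1`, region `[−1,0) × B₁`, apex `(0,0)`), in PINEAU–VICOL'S CLASS: the
hypothesis block (classical on the region, Type I (1.15), pointwise annular pressure (1.16)) is copied verbatim from the
tree's `pineauVicol2026_oneSlice_regularity`; the window field at `t̄` is `physWindowField 0 0 u t̄ = √(−t̄) u(t̄, √(−t̄)·)`. -/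

/-- **door S30 (v2) in the Pineau–Vicol frame.** -/
def PVVortexDefectPeepholeRegularity : Prop :=
  ∀ Cu : ℝ, 0 < Cu → ∀ (y₀ : EuclideanSpace ℝ (Fin 3)) (r : ℝ), 0 < r → ∃ ε : ℝ, 0 < ε ∧
    ∀ Cp : ℝ, 0 < Cp → ∃ s₀ : ℝ, 1 ≤ s₀ ∧
    ∀ (u : ℝ → EuclideanSpace ℝ (Fin 3) → EuclideanSpace ℝ (Fin 3)) (p : ℝ → EuclideanSpace ℝ (Fin 3) → ℝ),
      IsClassicalNSSolutionOnRegion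
        (Ico (-1 : ℝ) 0 ×ˢ ball (0 : EuclideanSpace ℝ (Fin 3)) 1) 1 0 u p →
      (∀ t ∈ Ico (-1 : ℝ) 0, ∀ x ∈ ball (0 : EuclideanSpace ℝ (Fin 3)) 1,
        ‖u t x‖ ≤ Cu / (Real.sqrt (-t) + ‖x‖)) →
      (∀ t ∈ Ico (-1 : ℝ) 0, ∀ x : EuclideanSpace ℝ (Fin 3), 1 / 2 < ‖x‖ → ‖x‖ < 3 / 4 → |p t x| ≤ Cp) →
      ∀ tbar : ℝ, -Real.exp (-s₀) < tbar → tbar < 0 →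
        (∀ y ∈ ball y₀ r, ‖vortexDefect 1 (physWindowField 0 0 u tbar) y‖ ≤ ε) →
        ∃ ϱ : ℝ, 0 < ϱ ∧ ∃ B : ℝ, ∀ t : ℝ, -ϱ ^ 2 < t → t < 0 →
          ∀ x ∈ ball (0 : EuclideanSpace ℝ (Fin 3)) ϱ, ‖u t x‖ ≤ B

/-- **FRAME stub (v2)** — the twin of S29 FILE 4b `targetPeepholeVorticity_of_pvInt` PLUS one new frame lemma: the parabolic
change of variables `t = T + βs`, `x = x₀ + λz`, `λ² = νβ` (tree `pv_typeI_transfer`, `pvFrame_isClassical`,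
`isBackwardBoundedAt_of_pv_bound`), the COVARIANCE `vortexDefect 1 (physWindowField 0 0 v s) z = vortexDefect ν
(physWindowField T x₀ u t) (√ν z)` for `v = (λ/ν) u(T + β·, x₀ + λ·)` (so the peephole becomes `B(y₀/√ν, r/√ν)`, same
`ε`), and — NEW versus S29, whose frame delivered only the INTEGRAL gauged pressure bound — the POINTWISE annular bound
(1.16) for the point-gauged pressure `p − p(·,x₁)` of a classical Leray–Hopf solution under decaying local Type I:
`|p̃[u(t)](x)| ≲ M²/ν + λ³ρ⁻³E₀`-type near/mid/far estimate of the normalised (Riesz) pressure on the window annulus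
(`SereginSverak2002.exists_pressure_gauge_of_classical`, Type-I envelopes on the annulus, energy tail), lateness `β` small. -/
def FrameTransferS30 : Prop := PVVortexDefectPeepholeRegularity → TargetVortexDefectPeephole

/-! ## §3 The bricks (PV frame, PV class) -/

/-- **TRANSFER · `VortexDefectPeepholeToCore`** (= K1ω + K2, PROVED below from them): for `C_u`, the peephole `(y₀, r)`, a
core radius `L ≥ 1` and a target `η > 0` there is `ε > 0` — BEFORE the pressure level — and for every `C_p` a lateness
`T₁ ∈ (0,1]`, such that at ONE `t̄ ∈ (−T₁, 0)`: `‖∂ₛΩ‖ ≤ ε` on the peephole ⇒ `‖∂ₛΩ‖ ≤ η` on the similarity core `B_L`. -/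
def VortexDefectPeepholeToCore : Prop :=
  ∀ Cu : ℝ, 0 < Cu → ∀ (y₀ : EuclideanSpace ℝ (Fin 3)) (r : ℝ), 0 < r → ∀ L : ℝ, 1 ≤ L → ∀ η : ℝ, 0 < η →
    ∃ ε : ℝ, 0 < ε ∧ ∀ Cp : ℝ, 0 < Cp → ∃ T₁ : ℝ, 0 < T₁ ∧ T₁ ≤ 1 ∧
    ∀ (u : ℝ → EuclideanSpace ℝ (Fin 3) → EuclideanSpace ℝ (Fin 3)) (p : ℝ → EuclideanSpace ℝ (Fin 3) → ℝ),
      IsClassicalNSSolutionOnRegion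
        (Ico (-1 : ℝ) 0 ×ˢ ball (0 : EuclideanSpace ℝ (Fin 3)) 1) 1 0 u p →
      (∀ t ∈ Ico (-1 : ℝ) 0, ∀ x ∈ ball (0 : EuclideanSpace ℝ (Fin 3)) 1,
        ‖u t x‖ ≤ Cu / (Real.sqrt (-t) + ‖x‖)) →
      (∀ t ∈ Ico (-1 : ℝ) 0, ∀ x : EuclideanSpace ℝ (Fin 3), 1 / 2 < ‖x‖ → ‖x‖ < 3 / 4 → |p t x| ≤ Cp) →
      ∀ tb ∈ Ioo (-T₁) 0,
        (∀ y ∈ ball y₀ r, ‖vortexDefect 1 (physWindowField 0 0 u tb) y‖ ≤ ε) →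
        ∀ y ∈ ball (0 : EuclideanSpace ℝ (Fin 3)) L, ‖vortexDefect 1 (physWindowField 0 0 u tb) y‖ ≤ η

/-- **LEG Cω · ONE-SLICE RIGIDITY OF THE QUIET VORTEX CORE** (shape of the hB-slot of the tree's
`pineauVicol2026_oneSlice_regularity_of_core'`, with the datum (1.17)-on-`B₁` replaced by `∂ₛΩ`-on-the-core): for `C_u`, a
target `θ > 0` and a radius `R ≥ 2` there are `η > 0` and a core radius `L ≥ 1`, and for every `C_p` a lateness `s₁ ≥ 1`, such
that `‖∂ₛΩ(·, s̄)‖ ≤ η` on `B_L` at ONE `t̄ ∈ (−e^{−s₁}, 0)` forces the L²-small core vorticity of PV Lemma 9.4,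
`∫_{B(2R√(−t̄))} |ω(t̄)|² ≤ θ²/(4√(−t̄))`.  [Proof path, all but one step in the tree: contradiction sequence `ηₙ = (n+2)⁻²`,
`Lₙ = n+2`, latenesses absorbing `C_p`; window fields `Fₙ = physWindowField 0 0 uₙ t̄ₙ` with `C³` bounds on `B̄(0,n+1)` from the
Type-I envelopes (`exists_forall_iteratedFDeriv_le_of_typeI_of_bounds`, levels `PineauVicolOneSlicePressure.B_u, B_p(C_u,C_p)`),
envelope `|Fₙ| ≤ C_u/(1+|y|)`, `div Fₙ = 0`; RADIAL-GAUGE POINCARÉ LEMMA (the one new elementary step): for `G ∈ C¹(B̄_ϱ; ℝ³)`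
and `Q(y) := ∫₀¹ G(sy)·y ds`, `∇Q − G = ∫₀¹ s · (y × curl G(sy)) ds`, so `‖G − ∇Q‖ ≤ (ϱ/2) sup_{B̄_ϱ} ‖curl G‖` — applied to
`G = N₁Fₙ`, `‖curl G‖ = ‖𝔇₁Fₙ‖ ≤ ηₙ` gives `‖−N₁Fₙ + ∇Qₙ‖ ≤ 1/(n+2)` on `B̄(0,n+1)`; then VERBATIM the tree's
`ScalingDefectPeepholeDoor.exists_curl_small_of_approxLerayProfiles` (ns-s30-p1, S30 P3 part 1: `C²_loc` limit = Leray profile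
`a = ½` in `L⁴` ⇒ `0` by `tsai_selfsimilar_holds` ⇒ small `∫_{B_{2R}}|curl Fₙ|²`), rescaled by `norm_curl_physWindowField`.
Irrotational parasites: datum `≡ 0` and `curl Fₙ ≡ 0`, consistent.] -/
def QuietVortexCoreRigidity : Prop :=
  ∀ Cu : ℝ, 0 < Cu → ∀ θ : ℝ, 0 < θ → ∀ R : ℝ, 2 ≤ R → ∃ η : ℝ, 0 < η ∧ ∃ L : ℝ, 1 ≤ L ∧
    ∀ Cp : ℝ, 0 < Cp → ∃ s₁ : ℝ, 1 ≤ s₁ ∧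
    ∀ (u : ℝ → EuclideanSpace ℝ (Fin 3) → EuclideanSpace ℝ (Fin 3)) (p : ℝ → EuclideanSpace ℝ (Fin 3) → ℝ),
      IsClassicalNSSolutionOnRegion
        (Ico (-1 : ℝ) 0 ×ˢ ball (0 : EuclideanSpace ℝ (Fin 3)) 1) 1 0 u p →
      (∀ t ∈ Ico (-1 : ℝ) 0, ∀ x ∈ ball (0 : EuclideanSpace ℝ (Fin 3)) 1,
        ‖u t x‖ ≤ Cu / (Real.sqrt (-t) + ‖x‖)) →
      (∀ t ∈ Ico (-1 : ℝ) 0, ∀ x : EuclideanSpace ℝ (Fin 3), 1 / 2 < ‖x‖ → ‖x‖ < 3 / 4 → |p t x| ≤ Cp) →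
      ∀ tb : ℝ, -Real.exp (-s₁) < tb → tb < 0 →
        (∀ y ∈ ball (0 : EuclideanSpace ℝ (Fin 3)) L, ‖vortexDefect 1 (physWindowField 0 0 u tb) y‖ ≤ η) →
        ∫⁻ x in ball (0 : EuclideanSpace ℝ (Fin 3)) (2 * R * Real.sqrt (-tb)),
            ENNReal.ofReal (‖curl (u tb) x‖ ^ 2) ≤ ENNReal.ofReal (θ ^ 2 / (4 * Real.sqrt (-tb)))

/-- **CORE-VORTICITY CRITERION · `RegularOfQuietCoreVorticity`** (support, in tree up to packaging): the body of the tree's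
`pineauVicol2026_oneSlice_regularity_of_core'` (resp. S29 `pvPeepholeRegularityInt_of_peepholeToCore`) AFTER its hB-slot —
universal `ε_CKN` (`pineauVicol_regular_of_zoom_small`), `θ = min(ϑ, √(ε_CKN/20))`, `R = max(R₀, 4JK²/θ²)` from
`pineauVicol_smallVorticity_propagation` (hA, proved), `exists_cknE_le_of_core_small`, the envelopes `K(C_u), K₂(C_u)`, and for
`C_p` the levels `B_u, B_p(C_u,C_p)`, the scale `c₁`, `T₀`: L²-small core vorticity at ONE late `t̄` ⇒ `(0,0)` regular. -/
def RegularOfQuietCoreVorticity : Prop :=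
  ∀ Cu : ℝ, 0 < Cu → ∃ θ : ℝ, 0 < θ ∧ ∃ R : ℝ, 2 ≤ R ∧ ∀ Cp : ℝ, 0 < Cp → ∃ s₂ : ℝ, 1 ≤ s₂ ∧
    ∀ (u : ℝ → EuclideanSpace ℝ (Fin 3) → EuclideanSpace ℝ (Fin 3)) (p : ℝ → EuclideanSpace ℝ (Fin 3) → ℝ),
      IsClassicalNSSolutionOnRegion
        (Ico (-1 : ℝ) 0 ×ˢ ball (0 : EuclideanSpace ℝ (Fin 3)) 1) 1 0 u p →
      (∀ t ∈ Ico (-1 : ℝ) 0, ∀ x ∈ ball (0 : EuclideanSpace ℝ (Fin 3)) 1,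
        ‖u t x‖ ≤ Cu / (Real.sqrt (-t) + ‖x‖)) →
      (∀ t ∈ Ico (-1 : ℝ) 0, ∀ x : EuclideanSpace ℝ (Fin 3), 1 / 2 < ‖x‖ → ‖x‖ < 3 / 4 → |p t x| ≤ Cp) →
      ∀ tb : ℝ, -Real.exp (-s₂) < tb → tb < 0 →
        (∫⁻ x in ball (0 : EuclideanSpace ℝ (Fin 3)) (2 * R * Real.sqrt (-tb)),
            ENNReal.ofReal (‖curl (u tb) x‖ ^ 2) ≤ ENNReal.ofReal (θ ^ 2 / (4 * Real.sqrt (-tb)))) →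
        ∃ ϱ : ℝ, 0 < ϱ ∧ ∃ B : ℝ, ∀ t : ℝ, -ϱ ^ 2 < t → t < 0 →
          ∀ x ∈ ball (0 : EuclideanSpace ℝ (Fin 3)) ϱ, ‖u t x‖ ≤ B

/-- **K1ω · VORTEX-DEFECT TUBE BOUND** (the first statement of the line not in print AS STATED): for `C_u` and a similarity
base radius `A ≥ 1` there are a similarity tube height `δ = δ(C_u, A) > 0` and a bound `K = K(C_u, A)`, and for every `C_p` a
lateness `T₁ ∈ (0,1]`, such that at every `t̄ ∈ (−T₁, 0)` the vorticity-defect profile `y ↦ ∂ₛΩ(y, s̄)` on `B_A` is the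
restriction of a map holomorphic on the local tube `localComplexTube 0 A δ` and bounded there by `K`.
[The slice `u(t̄,·)` extends with bound `C/√(elapsed time)` by Bradshaw–Grujić–Kukavica 2015 Thm 2.3 WITH the bound of its
scheme (tree `bradshawGrujicKukavica2015_local_analyticity_radius_holds`; bound `ρ₀` internal in
`BGK2015.Run.picardW_spec` / `norm_picardW_sub_lim_le` — plate L1 threads it into the conclusion), applied on the window
`[t̄ − t_e, t̄ + t_e] × B(4(A+2)√(−t̄))`, `t_e = c(C_u,A)·(−t̄)`, where Type I and its first envelope
(`exists_forall_fderiv_le_of_typeI_of_bounds`) give BGK's `A, D` levels and the pressure level `B` comes POINTWISE IN `t` from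
the Lemarié-Rieusset p. 469 / CKN split `ζp = p_far + q` (tree `CKNMorreyPressureSplit.pressureFarPart`, `CKNPressureDuality`):
`|p_far(t,·)| ≤ C·C_p` uses the pressure only where `∇ζ ≠ 0`, i.e. on the annulus `{1/2 < |x| < 3/4}` = (1.16), and
`q(t) = CZ[ζ∂∂(u⊗u)(t)]` has `‖q(t)‖_{L^{q/2}} ≲ ‖u(t)‖²_{L^q(B₁)}` (Type I) — lateness makes the `C_p` part invisible at the
similarity scale (PV print p. 33 `p = p_loc + h`); then `∂ₛΩ = curl N₁(U)` is a differential polynomial of order 3 in `U`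
with coefficient `y`: Cauchy estimates on a shrunken tube.  Irrotational parasites: `U = a∇φ` adds a term of size
`O(a) ≤ O(C_u)` to `U` and NOTHING to the datum; their pressure spike is excluded by (1.16).] -/
def VortexDefectTubeBound : Prop :=
  ∀ Cu : ℝ, 0 < Cu → ∀ A : ℝ, 1 ≤ A → ∃ δ : ℝ, 0 < δ ∧ ∃ K : ℝ, 0 < K ∧ ∀ Cp : ℝ, 0 < Cp → ∃ T₁ : ℝ, 0 < T₁ ∧ T₁ ≤ 1 ∧
    ∀ (u : ℝ → EuclideanSpace ℝ (Fin 3) → EuclideanSpace ℝ (Fin 3)) (p : ℝ → EuclideanSpace ℝ (Fin 3) → ℝ),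
      IsClassicalNSSolutionOnRegion
        (Ico (-1 : ℝ) 0 ×ˢ ball (0 : EuclideanSpace ℝ (Fin 3)) 1) 1 0 u p →
      (∀ t ∈ Ico (-1 : ℝ) 0, ∀ x ∈ ball (0 : EuclideanSpace ℝ (Fin 3)) 1,
        ‖u t x‖ ≤ Cu / (Real.sqrt (-t) + ‖x‖)) →
      (∀ t ∈ Ico (-1 : ℝ) 0, ∀ x : EuclideanSpace ℝ (Fin 3), 1 / 2 < ‖x‖ → ‖x‖ < 3 / 4 → |p t x| ≤ Cp) →
      ∀ tb ∈ Ioo (-T₁) 0,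
        ∃ F : EuclideanSpace ℂ (Fin 3) → EuclideanSpace ℂ (Fin 3),
          DifferentiableOn ℂ F (localComplexTube (0 : EuclideanSpace ℝ (Fin 3)) A δ) ∧
          (∀ z ∈ localComplexTube (0 : EuclideanSpace ℝ (Fin 3)) A δ, ‖F z‖ ≤ K) ∧
          ∀ y : EuclideanSpace ℝ (Fin 3), ‖y‖ < A →
            F (complexify y) = complexify (vortexDefect 1 (physWindowField 0 0 u tb) y)

/-- **K2 · TUBE PROPAGATION OF SMALLNESS** (unchanged from v1; pure complex analysis, TRUE: tree
`Literature.Analysis.Complex.TwoConstantsDisc.norm_le_two_constants_disc_of_norm_le` for the first step off the real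
peephole, then a Hadamard three-circles chain along the complex line through `y₀` and the target; expected witness
`ε = K (η/K)^{h^{-N}}`, `N ≍ (L + |y₀|)/δ`). -/
def TubePropagation : Prop :=
  ∀ (A δ K : ℝ), 0 < δ → 0 < K → ∀ (y₀ : EuclideanSpace ℝ (Fin 3)) (r : ℝ), 0 < r → ‖y₀‖ + r ≤ A / 2 →
    ∀ L : ℝ, 0 < L → L ≤ A / 2 → ∀ η : ℝ, 0 < η → ∃ ε : ℝ, 0 < ε ∧
    ∀ F : EuclideanSpace ℂ (Fin 3) → EuclideanSpace ℂ (Fin 3),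
      DifferentiableOn ℂ F (localComplexTube (0 : EuclideanSpace ℝ (Fin 3)) A δ) →
      (∀ z ∈ localComplexTube (0 : EuclideanSpace ℝ (Fin 3)) A δ, ‖F z‖ ≤ K) →
      (∀ y ∈ ball y₀ r, ‖F (complexify y)‖ ≤ ε) →
      ∀ y ∈ ball (0 : EuclideanSpace ℝ (Fin 3)) L, ‖F (complexify y)‖ ≤ η

/-! ## §4 Kernel-checked compositions -/

/-- **TRANSFER from the bricks:** K1ω + K2 ⇒ `VortexDefectPeepholeToCore` (similarity variables throughout: no rescaling). -/
theorem vortexDefectPeepholeToCore_of (h₁ : VortexDefectTubeBound) (h₂ : TubePropagation) :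
    VortexDefectPeepholeToCore := by
  intro Cu hCu y₀ r hr L hL η hη
  set A : ℝ := 2 * (L + ‖y₀‖ + r) + 2 with hA_def
  have hy₀ : 0 ≤ ‖y₀‖ := norm_nonneg _
  have hA1 : 1 ≤ A := by rw [hA_def]; nlinarith
  have hpeepA : ‖y₀‖ + r ≤ A / 2 := by rw [hA_def]; linarith
  have hL0 : 0 < L := by linarith
  have hLA : L ≤ A / 2 := by rw [hA_def]; linarith
  obtain ⟨δ, hδ, K, hK, hT⟩ := h₁ Cu hCu A hA1
  obtain ⟨ε, hε, hprop⟩ := h₂ A δ K hδ hK y₀ r hr hpeepA L hL0 hLA η hη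
  refine ⟨ε, hε, fun Cp hCp => ?_⟩
  obtain ⟨T₁, hT₁, hT₁1, hsol⟩ := hT Cp hCp
  refine ⟨T₁, hT₁, hT₁1, fun u p hcl hTI hP tb htb hpeep y hy => ?_⟩
  obtain ⟨F, hFhol, hFK, hFeq⟩ := hsol u p hcl hTI hP tb htb
  have hsmall : ∀ y ∈ ball y₀ r, ‖F (complexify y)‖ ≤ ε := by
    intro y' hy'
    have hyA : ‖y'‖ < A := by
      have h1 : ‖y' - y₀‖ < r := by rwa [mem_ball, dist_eq_norm] at hy'
      have : ‖y'‖ ≤ ‖y' - y₀‖ + ‖y₀‖ := by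
        calc ‖y'‖ = ‖(y' - y₀) + y₀‖ := by rw [sub_add_cancel]
          _ ≤ ‖y' - y₀‖ + ‖y₀‖ := norm_add_le _ _
      linarith
    rw [hFeq y' hyA, norm_complexify]
    exact hpeep y' hy'
  have hyA : ‖y‖ < A := by
    have : ‖y‖ < L := by rwa [mem_ball, dist_zero_right] at hy
    linarith
  have := hprop F hFhol hFK hsmall y hy
  rwa [hFeq y hyA, norm_complexify] at this

/-- **ASSEMBLY:** transfer + one-slice rigidity + core-vorticity criterion ⇒ the PV-frame door.  Thresholds: `θ, R` from the
criterion at `C_u`; `η, L` from rigidity at `(C_u, θ, R)`; `ε` from the transfer at `(C_u, y₀, r, L, η)` — all before `C_p`;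
lateness `s₀ = max(s₁, s₂, −log T₁)`. -/
theorem pvVortexDefectPeepholeRegularity_of (hT : VortexDefectPeepholeToCore) (hC : QuietVortexCoreRigidity)
    (hR : RegularOfQuietCoreVorticity) : PVVortexDefectPeepholeRegularity := by
  intro Cu hCu y₀ r hr
  obtain ⟨θ, hθ, R, hR2, hReg⟩ := hR Cu hCu
  obtain ⟨η, hη, L, hL, hRig⟩ := hC Cu hCu θ hθ R hR2
  obtain ⟨ε, hε, hTr⟩ := hT Cu hCu y₀ r hr L hL η hη
  refine ⟨ε, hε, fun Cp hCp => ?_⟩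
  obtain ⟨T₁, hT₁, -, hTr'⟩ := hTr Cp hCp
  obtain ⟨s₁, hs₁, hRig'⟩ := hRig Cp hCp
  obtain ⟨s₂, -, hReg'⟩ := hReg Cp hCp
  set s₀ : ℝ := max (max s₁ s₂) (-Real.log T₁) with hs₀_def
  refine ⟨s₀, le_trans hs₁ ((le_max_left _ _).trans (le_max_left _ _)), ?_⟩
  intro u p hcl hTI hP tbar htbar1 htbar0 hpeep
  have h1 : Real.exp (-s₀) ≤ Real.exp (-s₁) :=
    Real.exp_le_exp.2 (by linarith [(le_max_left s₁ s₂).trans (le_max_left (max s₁ s₂) (-Real.log T₁))])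
  have h2 : Real.exp (-s₀) ≤ Real.exp (-s₂) :=
    Real.exp_le_exp.2 (by linarith [(le_max_right s₁ s₂).trans (le_max_left (max s₁ s₂) (-Real.log T₁))])
  have h3 : Real.exp (-s₀) ≤ T₁ := by
    calc Real.exp (-s₀) ≤ Real.exp (Real.log T₁) :=
          Real.exp_le_exp.2 (by linarith [le_max_right (max s₁ s₂) (-Real.log T₁)])
      _ = T₁ := Real.exp_log hT₁
  have htb : tbar ∈ Ioo (-T₁) 0 := ⟨by linarith, htbar0⟩
  have hcore := hTr' u p hcl hTI hP tbar htb hpeep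
  have hsmallL2 := hRig' u p hcl hTI hP tbar (by linarith) htbar0 hcore
  exact hReg' u p hcl hTI hP tbar (by linarith) htbar0 hsmallL2

/-- **DOOR S30 (v2) from the line's inputs:** K1ω, K2, LEG Cω, the core-vorticity criterion and the frame stub. -/
theorem targetVortexDefectPeephole_of (h₁ : VortexDefectTubeBound) (h₂ : TubePropagation) (hC : QuietVortexCoreRigidity)
    (hR : RegularOfQuietCoreVorticity) (hF : FrameTransferS30) : TargetVortexDefectPeephole :=
  hF (pvVortexDefectPeepholeRegularity_of (vortexDefectPeepholeToCore_of h₁ h₂) hC hR)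

/-! ## §5 Sanity: the door implies the SEQUENTIAL form (solution-dependent lateness). -/

/-- the class-uniform one-time door implies its sequential form (lateness depending on the solution): smallness of the
vorticity defect on the peephole along ANY sequence of times `tₙ ↑ T` excludes the singularity. -/
theorem seq_of_target {ν M : ℝ} {y₀ : EuclideanSpace ℝ (Fin 3)} {r : ℝ} (h : TargetVortexDefectPeepholeAt ν M y₀ r) :
    ∃ ε : ℝ, 0 < ε ∧ ∀ (T : ℝ), 0 < T →
    ∀ (u : ℝ → EuclideanSpace ℝ (Fin 3) → EuclideanSpace ℝ (Fin 3)) (p : ℝ → EuclideanSpace ℝ (Fin 3) → ℝ),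
    IsClassicalNSSolutionOn (Set.Ico 0 T) ν 0 u p → IsLerayHopfOn T ν 0 (u 0) u → HasRapidSpatialDecay (u 0) →
    ∀ (x₀ : EuclideanSpace ℝ (Fin 3)) (ρ : ℝ), 0 < ρ →
    (∀ t ∈ Set.Ico 0 T, T - ρ ^ 2 < t → ∀ x ∈ Metric.ball x₀ ρ, ‖u t x‖ * (‖x - x₀‖ + Real.sqrt (ν * (T - t))) ≤ M) →
    ∀ (t : ℕ → ℝ), (∀ n, t n < T) → Tendsto t atTop (𝓝 T) →
    (∀ n, ∀ y ∈ Metric.ball y₀ r, ‖vortexDefect ν (physWindowField T x₀ u (t n)) y‖ ≤ ε) →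
    IsBackwardBoundedAt u T x₀ := by
  obtain ⟨ε, hε, h⟩ := h
  refine ⟨ε, hε, fun T hT u p hcl hLH hdec x₀ ρ hρ hM t htT ht hgood => ?_⟩
  obtain ⟨tstar, htstar, hts⟩ := h T ρ (VectorCalculus.kineticEnergy (u 0)) hT hρ
  obtain ⟨n, hn⟩ := (ht.eventually (lt_mem_nhds htstar)).exists
  exact hts u p hcl hLH hdec le_rfl x₀ hM (t n) ⟨hn, htT n⟩ (hgood n)

/-! ## §6 (appended, nsreg-p1 g25 ROUND-29 §7 / Sketch31 v2.1 363b5766493b6c28 Part B, verbatim): the EFFECTIVE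
quantifier order of LEG Cω — lateness before the pressure level. -/

/-- **LEG Cω, EFFECTIVE ORDER (`QuietVortexCoreRigidityU`)** — the body of the tree text `QuietVortexCoreRigidity`
(`ScalingDefectPeepholeDoorDefs`, p613681) with `∃ s₁` BEFORE `∀ C_p`: the gauge–Bernoulli route of ADDENDUM-28A
((A.1)–(A.6): `L̄Π_Q + |Ω|² = div D_Q − (U+½y)·D_Q` for the segment gauge `Q`, `|D_Q| ≤ (|y|/2) sup|𝔇₁F|`, tested against
Pineau–Vicol's weight `w_R̄`) produces `η(C_u,θ,R)`, `L(C_u,θ,R)` AND the lateness `s₁(C_u,θ,R)` from the vorticity-side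
envelopes only, which are pressure-free (Serrin 1962): the shell level `C_p` never enters.  Strictly stronger than the tree
text (lemma below); effective constants are the content of ADDENDUM-28A, not of this file. -/
def QuietVortexCoreRigidityU : Prop :=
  ∀ Cu : ℝ, 0 < Cu → ∀ θ : ℝ, 0 < θ → ∀ R : ℝ, 2 ≤ R → ∃ η : ℝ, 0 < η ∧ ∃ L : ℝ, 1 ≤ L ∧ ∃ s₁ : ℝ, 1 ≤ s₁ ∧
    ∀ Cp : ℝ, 0 < Cp →
    ∀ (u : ℝ → EuclideanSpace ℝ (Fin 3) → EuclideanSpace ℝ (Fin 3)) (p : ℝ → EuclideanSpace ℝ (Fin 3) → ℝ),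
      IsClassicalNSSolutionOnRegion
        (Ico (-1 : ℝ) 0 ×ˢ ball (0 : EuclideanSpace ℝ (Fin 3)) 1) 1 0 u p →
      (∀ t ∈ Ico (-1 : ℝ) 0, ∀ x ∈ ball (0 : EuclideanSpace ℝ (Fin 3)) 1,
        ‖u t x‖ ≤ Cu / (Real.sqrt (-t) + ‖x‖)) →
      (∀ t ∈ Ico (-1 : ℝ) 0, ∀ x : EuclideanSpace ℝ (Fin 3), 1 / 2 < ‖x‖ → ‖x‖ < 3 / 4 → |p t x| ≤ Cp) →
      ∀ tb : ℝ, -Real.exp (-s₁) < tb → tb < 0 →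
        (∀ y ∈ ball (0 : EuclideanSpace ℝ (Fin 3)) L, ‖vortexDefect 1 (physWindowField 0 0 u tb) y‖ ≤ η) →
        ∫⁻ x in ball (0 : EuclideanSpace ℝ (Fin 3)) (2 * R * Real.sqrt (-tb)),
            ENNReal.ofReal (‖curl (u tb) x‖ ^ 2) ≤ ENNReal.ofReal (θ ^ 2 / (4 * Real.sqrt (-tb)))

/-- The effective order implies the tree text (pure logic: a `C_p`-free lateness serves every `C_p`). -/
theorem quietVortexCoreRigidity_of_U (h : QuietVortexCoreRigidityU) : QuietVortexCoreRigidity := by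
  intro Cu hCu θ hθ R hR
  obtain ⟨η, hη, L, hL, s₁, hs₁, hall⟩ := h Cu hCu θ hθ R hR
  exact ⟨η, hη, L, hL, fun Cp hCp => ⟨s₁, hs₁, fun u p => hall Cp hCp u p⟩⟩

end Summit.NavierStokesRegularity.NavierStokesRegularity.Theorems.ScalingDefectPeepholeDoor

end
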